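import Summits.AtomisticToContinuum.Crystallization.Theorems.ExcessDecayLiouvillePhononStabilityCertRange

/-!
# Near-certificate: non-materialising sums over the exact ranges `{c : qlo < Q(c) ≤ qhi}`

Support file for crux `PhononStability` (stmt-AtomisticToContinuum-9333), line `contragredient-window-collapse`
(lead c2).  The far-field constant of the near certificate is a sum of a rational charge over all classes of
reference length in `(R_f, R_∞]` — tens of millions of classes for `R_∞ ≥ 100`.  `classRange qlo qhi`
(`…CertRange.lean`) enumerates that range exactly but materialises it as a list; here we define the SAME nested
loops with the summation pushed inside (`sumRange f qlo qhi`), so that a kernel/native evaluation runs in constant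
memory, and prove `sumRange f qlo qhi = ((classRange qlo qhi).map f).sum`. [folklore]
-/

namespace Summit.AtomisticToContinuum.Crystallization.Theorems.PhononStabilityCWC.Cert

/-- innermost loop summed: `Σ f` over `classCell` (a short list, materialised) -/
def sumCell (f : BondClass → ℚ) (qlo qhi : ℤ) (m m' : Fin 2) (n₂ n₁ : ℤ) : ℚ :=
  ((classCell qlo qhi m m' n₂ n₁).map f).sum

/-- middle loop summed -/
def sumSlab (f : BondClass → ℚ) (qlo qhi : ℤ) (m m' : Fin 2) (n₂ : ℤ) : ℚ :=
  ((coordStrip 3 (signDiff m m') (Int.sqrt (budget₂ qhi m m' n₂ / 3))).map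
    fun n₁ => sumCell f qlo qhi m m' n₂ n₁).sum

/-- outer loop summed -/
def sumBlock (f : BondClass → ℚ) (qlo qhi : ℤ) (m m' : Fin 2) : ℚ :=
  ((coordStrip 2 (signDiff m m') (Int.sqrt (qhi / 24))).map fun n₂ => sumSlab f qlo qhi m m' n₂).sum

/-- **the range sum** `Σ_{qlo < Q(c) ≤ qhi} f c`, computed without materialising the range -/
def sumRange (f : BondClass → ℚ) (qlo qhi : ℤ) : ℚ :=
  (sublPairs.map fun p => sumBlock f qlo qhi p.1 p.2).sum

/-- sum over a flat-mapped list, pushed inside. [folklore] -/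
theorem sum_map_flatMap {α β : Type*} (l : List α) (g : α → List β) (f : β → ℚ) :
    ((l.flatMap g).map f).sum = (l.map fun a => ((g a).map f).sum).sum := by
  induction l with
  | nil => rfl
  | cons a rest ih => rw [List.flatMap_cons, List.map_append, List.sum_append, ih, List.map_cons, List.sum_cons]

/-- the summed middle loop is the sum over `classSlab`. [folklore] -/
theorem sumSlab_eq (f : BondClass → ℚ) (qlo qhi : ℤ) (m m' : Fin 2) (n₂ : ℤ) :
    sumSlab f qlo qhi m m' n₂ = ((classSlab qlo qhi m m' n₂).map f).sum := by
  unfold sumSlab classSlab sumCell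
  rw [sum_map_flatMap]

/-- the summed outer loop is the sum over `classBlock`. [folklore] -/
theorem sumBlock_eq (f : BondClass → ℚ) (qlo qhi : ℤ) (m m' : Fin 2) :
    sumBlock f qlo qhi m m' = ((classBlock qlo qhi m m').map f).sum := by
  unfold sumBlock classBlock
  rw [sum_map_flatMap]
  congr 1
  exact List.map_congr_left fun n₂ _ => sumSlab_eq f qlo qhi m m' n₂

/-- **`sumRange` is the sum over `classRange`.** [folklore] -/
theorem sumRange_eq (f : BondClass → ℚ) (qlo qhi : ℤ) :
    sumRange f qlo qhi = ((classRange qlo qhi).map f).sum := by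
  unfold sumRange classRange
  rw [sum_map_flatMap]
  congr 1
  exact List.map_congr_left fun p _ => sumBlock_eq f qlo qhi p.1 p.2

/-- The range sum as a `Finset.sum` over the range viewed as a finset (the list is duplicate-free). [folklore] -/
theorem sumRange_eq_finset_sum (f : BondClass → ℚ) (qlo qhi : ℤ) :
    sumRange f qlo qhi = ∑ c ∈ (classRange qlo qhi).toFinset, f c := by
  rw [sumRange_eq, List.sum_toFinset _ (nodup_classRange qlo qhi)]



/-- Anchor of this support file (registered stub of the line skeleton, lead c2). -/
theorem stub_certRangeSum : ∀ (qlo qhi : ℤ) (f : BondClass → ℚ), ((classRange qlo qhi).map f).sum = ∑ c ∈ (classRange qlo qhi).toFinset, f c :=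
  by
  intro qlo qhi f
  rw [List.sum_toFinset _ (nodup_classRange qlo qhi)]

end Summit.AtomisticToContinuum.Crystallization.Theorems.PhononStabilityCWC.Cert
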